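import Mathlib.Analysis.Calculus.ParametricIntegral
import Mathlib.Analysis.Calculus.ContDiff.Bounds
import Mathlib.MeasureTheory.Integral.Bochner.ContinuousLinearMap
import HarnessLib

/-!
# Iterated differentiation under the integral sign

Analysis/Calculus support file (everything proved, theorems only). The `C^∞` form of
differentiation under the integral sign for a *measurable* family of smooth functions
(Hörmander, *The Analysis of Linear Partial Differential Operators I*, Thm. 1.1.9; Dieudonné,
*Foundations of Modern Analysis*, (8.11.2)): let `(A, μ)` be a measure space, `P` a real normed
space and `H : A → P → F` (`F` a real Banach space) such that

* every `H a` is `C^∞`,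
* for every `n` and `p`, `a ↦ Dⁿ(H a)(p)` is a.e.-strongly measurable,
* for every `n` there is `gₙ ∈ L¹(μ)` with `‖Dⁿ(H a)(p)‖ ≤ gₙ a` for all `a, p`.

Then `p ↦ ∫ H a p dμ` is `C^∞`, its iterated Fréchet derivatives are the integrals of those of
the `H a` (`iteratedFDeriv_integral_eq`, `contDiff_integral_of_dominated_iteratedFDeriv`), whence
`‖Dⁿ ∫ H a dμ‖ ≤ ∫ gₙ dμ` (`norm_iteratedFDeriv_integral_le`). The induction runs over the order
`n` for a fixed target space, through `iteratedFDeriv_succ_eq_comp_left` and one derivative under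
the integral sign (Mathlib's `hasFDerivAt_integral_of_dominated_of_fderiv_le`), so that no change
of target space (and no universe bookkeeping) is needed.

The measurability hypothesis is discharged in practice by *continuity in the parameter*; the
file records the tool for integrands manufactured from one jointly smooth function:
`iteratedFDeriv_comp_affine` (`Dⁿ[Φ(L · + c)](p) = DⁿΦ(Lp + c) ∘ (L, …, L)`), its norm bound, and
`continuous_iteratedFDeriv_comp_affine` (continuity of `(q, p) ↦ Dⁿ[Φ(L · + c q)](p)`).

This is the companion, for general measures, of the tree's
`Literature.Analysis.FunctionSpaces.contDiff_parametric_intervalIntegral` (compact intervals,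
jointly smooth integrands); it is the form needed for collision integrals over
`E × S^{d-1}` and for Duhamel integrals whose integrand is only measurable in time.

## Mathlib search

`hasFDerivAt_integral_of_dominated_of_fderiv_le` (one derivative), `continuous_of_dominated`,
`ContinuousLinearMap.iteratedFDeriv_comp_right`, `iteratedFDeriv_comp_add_right`; no `ContDiff`
or `iteratedFDeriv` statement for parametric integrals over a general measure (searched
`iteratedFDeriv.*integral`, `contDiff.*integral_of`: none).

## References

* L. Hörmander, *The Analysis of Linear Partial Differential Operators I*, 2nd ed. (1990),
  Thm. 1.1.9.
* J. Dieudonné, *Foundations of Modern Analysis* (1960), (8.11.2).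
-/

noncomputable section

open MeasureTheory Set Filter Function Metric
open scoped Topology ContDiff

namespace Literature.Analysis.Calculus

variable {A : Type*} [MeasurableSpace A] {μ : Measure A}
variable {P : Type*} [NormedAddCommGroup P] [NormedSpace ℝ P]
variable {F : Type*} [NormedAddCommGroup F] [NormedSpace ℝ F]

/-! ### One derivative under the integral sign for a differentiable family -/

/-- **One derivative under the integral sign** for a family `K : A → P → G` of differentiable
functions, measurable in `a` together with its derivative, both dominated by integrable
functions independent of the point: `p ↦ ∫ K a p dμ` has derivative `∫ D(K a)(p) dμ`
(Mathlib's `hasFDerivAt_integral_of_dominated_of_fderiv_le` with a global neighbourhood). [folklore] -/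
theorem hasFDerivAt_integral_of_dominated_global {K : A → P → F}
    (hK : ∀ a, Differentiable ℝ (K a))
    (h0m : ∀ p, AEStronglyMeasurable (fun a => K a p) μ)
    (h1m : ∀ p, AEStronglyMeasurable (fun a => fderiv ℝ (K a) p) μ)
    {g₀ : A → ℝ} (hg₀ : Integrable g₀ μ) (h0b : ∀ a p, ‖K a p‖ ≤ g₀ a)
    {g₁ : A → ℝ} (hg₁ : Integrable g₁ μ) (h1b : ∀ a p, ‖fderiv ℝ (K a) p‖ ≤ g₁ a) (p₀ : P) :
    HasFDerivAt (fun p => ∫ a, K a p ∂μ) (∫ a, fderiv ℝ (K a) p₀ ∂μ) p₀ := by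
  have hint : Integrable (fun a => K a p₀) μ :=
    hg₀.mono' (h0m p₀) (Eventually.of_forall fun a => h0b a p₀)
  exact hasFDerivAt_integral_of_dominated_of_fderiv_le (𝕜 := ℝ) (F := fun p a => K a p)
    (F' := fun p a => fderiv ℝ (K a) p) (bound := g₁) univ_mem (Eventually.of_forall h0m) hint
    (h1m p₀) (Eventually.of_forall fun a p _ => h1b a p) hg₁
    (Eventually.of_forall fun a p _ => ((hK a) p).hasFDerivAt)

/-! ### Measurability and norms of the derivative family -/

/-- `fderiv (Dⁿ f) (p) = curryLeft (Dⁿ⁺¹ f (p))`. [folklore] -/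
theorem fderiv_iteratedFDeriv_eq_curry (f : P → F) (n : ℕ) (p : P) :
    fderiv ℝ (iteratedFDeriv ℝ n f) p =
      continuousMultilinearCurryLeftEquiv ℝ (fun _ : Fin (n + 1) => P) F
        (iteratedFDeriv ℝ (n + 1) f p) := by
  rw [iteratedFDeriv_succ_eq_comp_left, comp_apply, LinearIsometryEquiv.apply_symm_apply]

/-- Measurability in the parameter of `a ↦ fderiv (Dⁿ (H a)) (p)` from that of
`a ↦ Dⁿ⁺¹ (H a) (p)`. [folklore] -/
theorem aestronglyMeasurable_fderiv_iteratedFDeriv {H : A → P → F} {n : ℕ} {p : P}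
    (h : AEStronglyMeasurable (fun a => iteratedFDeriv ℝ (n + 1) (H a) p) μ) :
    AEStronglyMeasurable (fun a => fderiv ℝ (iteratedFDeriv ℝ n (H a)) p) μ := by
  simp_rw [fderiv_iteratedFDeriv_eq_curry]
  exact (continuousMultilinearCurryLeftEquiv ℝ (fun _ : Fin (n + 1) => P) F).continuous
    |>.comp_aestronglyMeasurable h

/-- Measurability in the parameter of `a ↦ H a p` from that of `a ↦ D⁰ (H a) (p)`. [folklore] -/
theorem aestronglyMeasurable_of_iteratedFDeriv_zero {H : A → P → F} {p : P}
    (h : AEStronglyMeasurable (fun a => iteratedFDeriv ℝ 0 (H a) p) μ) :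
    AEStronglyMeasurable (fun a => H a p) μ := by
  have heq : (fun a => H a p) = fun a => (iteratedFDeriv ℝ 0 (H a) p) 0 := by
    funext a
    rfl
  rw [heq]
  exact (continuous_eval_const (0 : Fin 0 → P)).comp_aestronglyMeasurable h

/-! ### Iterated derivatives of the integral -/

/-- **Iterated differentiation under the integral sign, the formula.** Under the standing
hypotheses (smooth family, derivatives measurable in the parameter and dominated, at every
order, by integrable functions independent of the point), for every `n` and `p`,
`Dⁿ (∫ H a dμ) (p) = ∫ Dⁿ (H a) (p) dμ`, and `Dⁿ (∫ H a dμ)` has derivative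
`∫ fderiv (Dⁿ (H a)) (p) dμ` at `p`. [folklore] -/
theorem iteratedFDeriv_integral_eq_and_hasFDerivAt [CompleteSpace F] {H : A → P → F}
    (h1 : ∀ a, ContDiff ℝ ∞ (H a))
    (h2 : ∀ (n : ℕ) (p : P), AEStronglyMeasurable (fun a => iteratedFDeriv ℝ n (H a) p) μ)
    (h3 : ∀ n : ℕ, ∃ g : A → ℝ, Integrable g μ ∧ ∀ a p, ‖iteratedFDeriv ℝ n (H a) p‖ ≤ g a)
    (n : ℕ) :
    (∀ p, iteratedFDeriv ℝ n (fun p => ∫ a, H a p ∂μ) p = ∫ a, iteratedFDeriv ℝ n (H a) p ∂μ) ∧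
      ∀ p, HasFDerivAt (iteratedFDeriv ℝ n fun p => ∫ a, H a p ∂μ)
        (∫ a, fderiv ℝ (iteratedFDeriv ℝ n (H a)) p ∂μ) p := by
  -- the derivative statement at order `n` from the formula at order `n`
  have hderiv : ∀ n : ℕ,
      (∀ p, iteratedFDeriv ℝ n (fun p => ∫ a, H a p ∂μ) p = ∫ a, iteratedFDeriv ℝ n (H a) p ∂μ) →
      ∀ p, HasFDerivAt (iteratedFDeriv ℝ n fun p => ∫ a, H a p ∂μ)
        (∫ a, fderiv ℝ (iteratedFDeriv ℝ n (H a)) p ∂μ) p := by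
    intro n hn p
    have heq : (iteratedFDeriv ℝ n fun p => ∫ a, H a p ∂μ) =
        fun p => ∫ a, iteratedFDeriv ℝ n (H a) p ∂μ := funext hn
    rw [heq]
    obtain ⟨g₀, hg₀, hb₀⟩ := h3 n
    obtain ⟨g₁, hg₁, hb₁⟩ := h3 (n + 1)
    have hlt : (n : ℕ∞ω) < ∞ := by exact_mod_cast WithTop.coe_lt_coe.2 (ENat.coe_lt_top n)
    refine hasFDerivAt_integral_of_dominated_global (K := fun a => iteratedFDeriv ℝ n (H a))
      (fun a => (h1 a).differentiable_iteratedFDeriv hlt) (h2 n)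
      (fun p => aestronglyMeasurable_fderiv_iteratedFDeriv (h2 (n + 1) p)) hg₀ hb₀ hg₁
      (fun a p => ?_) p
    rw [norm_fderiv_iteratedFDeriv]
    exact hb₁ a p
  suffices hform : ∀ p, iteratedFDeriv ℝ n (fun p => ∫ a, H a p ∂μ) p =
      ∫ a, iteratedFDeriv ℝ n (H a) p ∂μ from ⟨hform, hderiv n hform⟩
  induction n with
  | zero =>
    intro p
    rw [iteratedFDeriv_zero_eq_comp, comp_apply]
    simp_rw [iteratedFDeriv_zero_eq_comp]
    exact ((continuousMultilinearCurryFin0 ℝ P F).symm.toLinearIsometry.integral_comp_comm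
      (fun a => H a p)).symm
  | succ n ih =>
    intro p
    have hD := hderiv n ih p
    rw [iteratedFDeriv_succ_eq_comp_left, comp_apply, hD.fderiv]
    simp_rw [iteratedFDeriv_succ_eq_comp_left]
    exact (ContinuousLinearEquiv.integral_comp_comm (𝕜 := ℝ)
      (continuousMultilinearCurryLeftEquiv ℝ (fun _ : Fin (n + 1) => P) F).symm.toContinuousLinearEquiv
        (fun a => fderiv ℝ (iteratedFDeriv ℝ n (H a)) p)).symm

/-- **Iterated differentiation under the integral sign**: `Dⁿ (∫ H a dμ) (p) = ∫ Dⁿ (H a) (p) dμ`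
(Hörmander, Thm. 1.1.9). [folklore] -/
theorem iteratedFDeriv_integral_eq [CompleteSpace F] {H : A → P → F}
    (h1 : ∀ a, ContDiff ℝ ∞ (H a))
    (h2 : ∀ (n : ℕ) (p : P), AEStronglyMeasurable (fun a => iteratedFDeriv ℝ n (H a) p) μ)
    (h3 : ∀ n : ℕ, ∃ g : A → ℝ, Integrable g μ ∧ ∀ a p, ‖iteratedFDeriv ℝ n (H a) p‖ ≤ g a)
    (n : ℕ) (p : P) :
    iteratedFDeriv ℝ n (fun p => ∫ a, H a p ∂μ) p = ∫ a, iteratedFDeriv ℝ n (H a) p ∂μ :=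
  (iteratedFDeriv_integral_eq_and_hasFDerivAt h1 h2 h3 n).1 p

/-- **Smooth dependence on parameters, general measures**: under the standing hypotheses
`p ↦ ∫ H a p dμ` is `C^∞` (Hörmander, Thm. 1.1.9; Dieudonné (8.11.2)). [folklore] -/
theorem contDiff_integral_of_dominated_iteratedFDeriv [CompleteSpace F] {H : A → P → F}
    (h1 : ∀ a, ContDiff ℝ ∞ (H a))
    (h2 : ∀ (n : ℕ) (p : P), AEStronglyMeasurable (fun a => iteratedFDeriv ℝ n (H a) p) μ)
    (h3 : ∀ n : ℕ, ∃ g : A → ℝ, Integrable g μ ∧ ∀ a p, ‖iteratedFDeriv ℝ n (H a) p‖ ≤ g a) :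
    ContDiff ℝ ∞ fun p => ∫ a, H a p ∂μ :=
  contDiff_of_differentiable_iteratedFDeriv fun m _ p =>
    ((iteratedFDeriv_integral_eq_and_hasFDerivAt h1 h2 h3 m).2 p).differentiableAt

/-- **Bounds for the derivatives of a parametric integral**: if `‖Dⁿ (H a) (p)‖ ≤ g a` with `g`
integrable, then `‖Dⁿ (∫ H a dμ) (p)‖ ≤ ∫ g dμ`. [folklore] -/
theorem norm_iteratedFDeriv_integral_le [CompleteSpace F] {H : A → P → F}
    (h1 : ∀ a, ContDiff ℝ ∞ (H a))
    (h2 : ∀ (n : ℕ) (p : P), AEStronglyMeasurable (fun a => iteratedFDeriv ℝ n (H a) p) μ)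
    (h3 : ∀ n : ℕ, ∃ g : A → ℝ, Integrable g μ ∧ ∀ a p, ‖iteratedFDeriv ℝ n (H a) p‖ ≤ g a)
    {n : ℕ} {p : P} {g : A → ℝ} (hg : Integrable g μ)
    (hb : ∀ a, ‖iteratedFDeriv ℝ n (H a) p‖ ≤ g a) :
    ‖iteratedFDeriv ℝ n (fun p => ∫ a, H a p ∂μ) p‖ ≤ ∫ a, g a ∂μ := by
  rw [iteratedFDeriv_integral_eq h1 h2 h3]
  exact norm_integral_le_of_norm_le hg (Eventually.of_forall hb)

omit [NormedAddCommGroup P] [NormedSpace ℝ P] in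
/-- The integral itself is dominated: `‖∫ H a p dμ‖ ≤ ∫ g dμ` if `‖H a p‖ ≤ g a`. [folklore] -/
theorem norm_integral_le_of_forall_le {H : A → P → F} {p : P} {g : A → ℝ} (hg : Integrable g μ)
    (hb : ∀ a, ‖H a p‖ ≤ g a) : ‖∫ a, H a p ∂μ‖ ≤ ∫ a, g a ∂μ :=
  norm_integral_le_of_norm_le hg (Eventually.of_forall hb)

/-! ### Integrands manufactured from a jointly smooth function -/

section Affine

variable {Q : Type*} [NormedAddCommGroup Q] [NormedSpace ℝ Q]

/-- **Affine precomposition**: for `Φ` smooth, a continuous linear `L : P → Q` and `c ∈ Q`,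
`Dⁿ[p ↦ Φ(L p + c)](p) = DⁿΦ(L p + c) ∘ (L, …, L)`. [folklore] -/
theorem iteratedFDeriv_comp_affine {Φ : Q → F} {N : ℕ∞ω} (hΦ : ContDiff ℝ N Φ) (L : P →L[ℝ] Q)
    (c : Q) {n : ℕ} (hn : (n : ℕ∞ω) ≤ N) (p : P) :
    iteratedFDeriv ℝ n (fun p => Φ (L p + c)) p =
      (iteratedFDeriv ℝ n Φ (L p + c)).compContinuousLinearMap fun _ => L := by
  have heq : (fun p => Φ (L p + c)) = (fun y => Φ (y + c)) ∘ L := rfl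
  have h2 : ContDiff ℝ N fun y => Φ (y + c) := hΦ.comp (contDiff_id.add contDiff_const)
  rw [heq, L.iteratedFDeriv_comp_right h2 p hn, iteratedFDeriv_comp_add_right]

/-- Norm bound for affine precomposition: `‖Dⁿ[Φ(L · + c)](p)‖ ≤ ‖DⁿΦ(Lp + c)‖ ‖L‖ⁿ`. [folklore] -/
theorem norm_iteratedFDeriv_comp_affine_le {Φ : Q → F} {N : ℕ∞ω} (hΦ : ContDiff ℝ N Φ)
    (L : P →L[ℝ] Q) (c : Q) {n : ℕ} (hn : (n : ℕ∞ω) ≤ N) (p : P) :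
    ‖iteratedFDeriv ℝ n (fun p => Φ (L p + c)) p‖ ≤ ‖iteratedFDeriv ℝ n Φ (L p + c)‖ * ‖L‖ ^ n := by
  rw [iteratedFDeriv_comp_affine hΦ L c hn]
  refine (ContinuousMultilinearMap.norm_compContinuousLinearMap_le _ _).trans (le_of_eq ?_)
  rw [Finset.prod_const, Finset.card_univ, Fintype.card_fin]

/-- Affine precomposition by a map of norm at most one does not increase the derivatives:
`‖Dⁿ[Φ(L · + c)](p)‖ ≤ ‖DⁿΦ(Lp + c)‖` if `‖L‖ ≤ 1`. [folklore] -/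
theorem norm_iteratedFDeriv_comp_affine_le_of_norm_le_one {Φ : Q → F} {N : ℕ∞ω}
    (hΦ : ContDiff ℝ N Φ) {L : P →L[ℝ] Q} (hL : ‖L‖ ≤ 1) (c : Q) {n : ℕ} (hn : (n : ℕ∞ω) ≤ N)
    (p : P) :
    ‖iteratedFDeriv ℝ n (fun p => Φ (L p + c)) p‖ ≤ ‖iteratedFDeriv ℝ n Φ (L p + c)‖ := by
  refine (norm_iteratedFDeriv_comp_affine_le hΦ L c hn p).trans ?_
  exact mul_le_of_le_one_right (norm_nonneg _) (pow_le_one₀ (norm_nonneg _) hL)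

/-- **Continuity in the parameter of partial iterated derivatives**: for `Φ` smooth,
`L : P → Q` continuous linear and a continuous `c : C → Q`, the map
`(q, p) ↦ Dⁿ[p ↦ Φ(L p + c q)](p)` is continuous; in particular it is measurable in `q` for every
`p`, which is how the measurability hypothesis of `iteratedFDeriv_integral_eq` is met for
integrands obtained by evaluating one smooth function along parameter-dependent affine maps. [folklore] -/
theorem continuous_iteratedFDeriv_comp_affine {C : Type*} [TopologicalSpace C] {Φ : Q → F}
    (hΦ : ContDiff ℝ ∞ Φ) (L : P →L[ℝ] Q) {c : C → Q} (hc : Continuous c) (n : ℕ) :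
    Continuous fun q : C × P => iteratedFDeriv ℝ n (fun p => Φ (L p + c q.1)) q.2 := by
  have hn : (n : ℕ∞ω) ≤ ∞ := by exact_mod_cast le_top
  have heq : (fun q : C × P => iteratedFDeriv ℝ n (fun p => Φ (L p + c q.1)) q.2) =
      fun q : C × P => ContinuousMultilinearMap.compContinuousLinearMapL (fun _ : Fin n => L)
        (iteratedFDeriv ℝ n Φ (L q.2 + c q.1)) := by
    funext q
    rw [iteratedFDeriv_comp_affine hΦ L (c q.1) hn]
    rfl
  rw [heq]
  exact (ContinuousMultilinearMap.compContinuousLinearMapL fun _ : Fin n => L).continuous.comp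
    ((hΦ.continuous_iteratedFDeriv hn).comp
      ((L.continuous.comp continuous_snd).add (hc.comp continuous_fst)))

/-- Measurability form of `continuous_iteratedFDeriv_comp_affine`: for fixed `p`,
`q ↦ Dⁿ[Φ(L · + c q)](p)` is continuous. [folklore] -/
theorem continuous_iteratedFDeriv_comp_affine_param {C : Type*} [TopologicalSpace C] {Φ : Q → F}
    (hΦ : ContDiff ℝ ∞ Φ) (L : P →L[ℝ] Q) {c : C → Q} (hc : Continuous c) (n : ℕ) (p : P) :
    Continuous fun q : C => iteratedFDeriv ℝ n (fun p => Φ (L p + c q)) p :=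
  (continuous_iteratedFDeriv_comp_affine hΦ L hc n).comp (continuous_id.prodMk continuous_const)

end Affine

end Literature.Analysis.Calculus

end
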